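import Literature.NumberTheory.LFunctions.Zhang2022.Section10Lemma101Tent
import Literature.NumberTheory.LFunctions.Zhang2022.Section10Lemma101ShortMeans
import HarnessLib

/-!
# Zhang (2022), Lemma 10.1, part 4/5: all Riesz means up to `P` are `O(𝓛²)`; (10.3) and (10.4)

Topic `Literature/NumberTheory/LFunctions/Zhang2022` (Landau–Siegel audit tree; verdict-neutral).
Y. Zhang, *Discrete mean estimates and the Landau–Siegel zero*, arXiv:2211.02515v1 (2022)
[Zhang2022LandauSiegel] — **an unrefereed manuscript under adjudication**; this file proves one of
its lemmas from the manuscript's own definitions and asserts nothing about its Theorems 1–2.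
Cell siegel-zhang (D-0069 width campaign), discharge of DAG node `Z22:Lem10.1` / proof node
`Z22:Lem10.1.pf` [Z22 pp. 53–54, (10.2)–(10.7), tex L2723–2788], skeleton node
`Skeleton.Lemma101 c′` (`SkeletonPartTwo`), cone C24 of `theorem1_of_leaves`.

Content: (i) `norm_riesz_le` — for `0 < X ≤ P` every Riesz mean `A(X)` is `O_{c′}(𝓛²)` (short `X`
by part 3; `T ≤ X ≤ P` by the tree's Lemma 8.2 core `Lemma82.sum_twist_log_sub_main_le` and
`‖L′(1,χ)‖ ≪ 𝓛²`, `Lemma31.norm_deriv_LFunction_le_near_one`); (ii) the parameters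
`log P = 𝓛⁹`, `T = exp 𝓛^{1.1}`, `P^a = exp(a𝓛⁹)` and the shifts `β_j` (purely imaginary,
`‖β_j‖ ≤ (3+5c′)α`, from `Lemma82.shifts_bound`); (iii) **(10.3)** `range_two` and **(10.4)**
`range_three` with the printed main terms `(500L′(1,χ)/log P)(−1 − β_j log(y/P^{0.5}))`,
`(500L′(1,χ)/log P)(1 − β_j log(P^{0.504}/y))` and error `≤ 1500·C82(3+5c′)𝓛⁻¹⁵`: the long pieces
are evaluated by Lemma 8.2's core and the main terms combine exactly
(`log X₁ − 2log X₂ = log(y/P^{0.5})`); (iv) the consecutive differences of the `f̃`-weights used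
for (10.2).

## References
* Y. Zhang, arXiv:2211.02515v1 (2022), §10 Lemma 10.1, (10.3), (10.4), (10.7); §8 Lemma 8.2;
  §5 Lemma 5.8. [cite: Zhang2022LandauSiegel, §10 Lemma 10.1]
-/

noncomputable section

open Complex Real

namespace Literature.NumberTheory.LFunctions.Zhang2022.Lemma101

open Literature.NumberTheory.LFunctions.Zhang2022.Skeleton
open Literature.NumberTheory.LFunctions.Zhang2022.Lemma82 (twist C82)

variable {D : ℕ} (χ : DirichletCharacter ℂ D)

/-! ### §5. All the Riesz means up to `P` are `O(𝓛²)`; the long ones by Lemma 8.2's core -/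

omit χ in
/-- The Lemma 8.2 constant `C82(K)` is non-negative. [cite: Zhang2022LandauSiegel, §8 Lemma 8.2] -/
theorem C82_nonneg {K : ℝ} (hK : 0 ≤ K) : 0 ≤ C82 K := by
  unfold C82
  have := Lemma82.I0_nonneg
  positivity

/-- **Uniform bound**: for `0 < X ≤ P = exp(𝓛⁹)` (same hypotheses as `norm_riesz_short_le`),
`‖Σ_{m≤X} χ(m)m^{−1−δ}log(X/m)‖ ≤ (5 + 4Kπ + 4e^{9/2}(1 + Kπ) + C82(K))𝓛²`: short `X` by
`norm_riesz_short_le`, long `X ≥ T` by `Lemma82.sum_twist_log_sub_main_le` and `‖L′(1,χ)‖ ≪ 𝓛²`.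
[cite: Zhang2022LandauSiegel, §10 proof of Lemma 10.1] -/
theorem norm_riesz_le [NeZero D] (hprim : χ.IsPrimitive) {K : ℝ} (hK0 : 0 ≤ K)
    (hL : 200 + K * π ≤ Real.log D) (hA : ‖χ.LFunction 1‖ ≤ 1 / Real.log D ^ 2022)
    {δ : ℂ} (hδre : δ.re = 0) (hδ : ‖δ‖ ≤ K * π / Real.log D ^ 9)
    {X : ℝ} (hX0 : 0 < X) (hXP : X ≤ Real.exp (Real.log D ^ 9)) :
    ‖∑ m ∈ Finset.Ioc 0 ⌊X⌋₊, twist χ δ m * (Real.log (X / m) : ℂ)‖ ≤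
      (5 + 4 * K * π + 4 * Real.exp (9 / 2) * (1 + K * π) + C82 K) * Real.log D ^ 2 := by
  obtain ⟨hD2, hL200, hDexp, hsqrt, hKπL⟩ := basics_of_large (D := D) hK0 hL
  have hπ := Real.pi_pos
  set L : ℝ := Real.log D with hLdef
  have hL1 : 1 ≤ L := by linarith
  have hL3 : 3 ≤ L := by linarith
  have hKπ : 0 ≤ K * π := by positivity
  have hC82 := C82_nonneg hK0
  have hE : 0 ≤ 4 * Real.exp (9 / 2) * (1 + K * π) := by positivity
  by_cases hXT : X ≤ Real.exp (L ^ (11 / 10 : ℝ))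
  · refine (norm_riesz_short_le χ hprim hK0 hL hA hδre hδ hX0 hXT).trans ?_
    have : 0 ≤ (4 * Real.exp (9 / 2) * (1 + K * π) + C82 K) * L ^ 2 := by positivity
    nlinarith
  · have hTX : Real.exp (L ^ (11 / 10 : ℝ)) ≤ X := (not_le.mp hXT).le
    have hK4 : 4 * K * π ≤ L ^ 8 := by
      calc 4 * K * π = 4 * (K * π) := by ring
        _ ≤ 4 * L := by linarith
        _ ≤ L ^ 7 * L := by
            refine mul_le_mul_of_nonneg_right ?_ (by linarith)
            calc (4 : ℝ) ≤ 3 ^ 7 := by norm_num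
              _ ≤ L ^ 7 := pow_le_pow_left₀ (by norm_num) hL3 7
        _ = L ^ 8 := by ring
    have hmain := Lemma82.sum_twist_log_sub_main_le χ hprim hL3 hA hK0 hK4 hδre hδ hTX hXP
    have hX1 : 1 ≤ X := le_trans (Real.one_le_exp (by positivity)) hTX
    have hlogX0 : 0 ≤ Real.log X := Real.log_nonneg hX1
    have hlogX : Real.log X ≤ L ^ 9 := (Real.log_le_iff_le_exp hX0).mpr hXP
    have hL' : ‖deriv χ.LFunction 1‖ ≤ 2 * Real.exp (9 / 2) * (1 + L) * L :=
      Lemma31.norm_deriv_LFunction_le_near_one χ hL3 hprim (w := 1) (by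
        rw [sub_self, norm_zero]
        exact div_nonneg zero_le_one (by rw [← hLdef]; linarith))
    have hfac : ‖(1 : ℂ) + δ * (Real.log X : ℂ)‖ ≤ 1 + K * π := by
      calc ‖(1 : ℂ) + δ * (Real.log X : ℂ)‖ ≤ ‖(1 : ℂ)‖ + ‖δ * (Real.log X : ℂ)‖ := norm_add_le _ _
        _ = 1 + ‖δ‖ * Real.log X := by
            rw [norm_one, norm_mul, Complex.norm_real, Real.norm_of_nonneg hlogX0]
        _ ≤ 1 + K * π / L ^ 9 * L ^ 9 := by gcongr
        _ = 1 + K * π := by field_simp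
    have hmt : ‖deriv χ.LFunction 1 * (1 + δ * (Real.log X : ℂ))‖ ≤
        4 * Real.exp (9 / 2) * (1 + K * π) * L ^ 2 := by
      rw [norm_mul]
      calc ‖deriv χ.LFunction 1‖ * ‖(1 : ℂ) + δ * (Real.log X : ℂ)‖
          ≤ (2 * Real.exp (9 / 2) * (1 + L) * L) * (1 + K * π) :=
            mul_le_mul hL' hfac (norm_nonneg _) (by positivity)
        _ ≤ (2 * Real.exp (9 / 2) * (2 * L) * L) * (1 + K * π) := by gcongr; linarith
        _ = 4 * Real.exp (9 / 2) * (1 + K * π) * L ^ 2 := by ring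
    have herr : C82 K / L ^ 6 ≤ C82 K * L ^ 2 := by
      rw [div_le_iff₀ (by positivity)]
      calc C82 K = C82 K * 1 := (mul_one _).symm
        _ ≤ C82 K * (L ^ 2 * L ^ 6) :=
            mul_le_mul_of_nonneg_left (one_le_mul_of_one_le_of_one_le (one_le_pow₀ hL1)
              (one_le_pow₀ hL1)) hC82
        _ = C82 K * L ^ 2 * L ^ 6 := by ring
    calc ‖∑ m ∈ Finset.Ioc 0 ⌊X⌋₊, twist χ δ m * (Real.log (X / m) : ℂ)‖
        = ‖deriv χ.LFunction 1 * (1 + δ * (Real.log X : ℂ)) +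
            ((∑ m ∈ Finset.Ioc 0 ⌊X⌋₊, twist χ δ m * (Real.log (X / m) : ℂ)) -
              deriv χ.LFunction 1 * (1 + δ * (Real.log X : ℂ)))‖ := by rw [add_sub_cancel]
      _ ≤ 4 * Real.exp (9 / 2) * (1 + K * π) * L ^ 2 + C82 K * L ^ 2 :=
          (norm_add_le _ _).trans (add_le_add hmt (hmain.trans herr))
      _ ≤ _ := by nlinarith

/-! ### §6. The parameters of §2 and the shifts `β_j` -/

omit χ in
/-- `log P = 𝓛⁹`, `T = exp(𝓛^{1.1})`, `P^a = exp(a𝓛⁹)`. [cite: Zhang2022LandauSiegel, §2 (2.6), §6] -/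
theorem params (D : ℕ) : Real.log (bigP D) = Real.log D ^ 9 ∧
    bigT D = Real.exp (Real.log D ^ (11 / 10 : ℝ)) ∧
    ∀ a : ℝ, bigP D ^ a = Real.exp (a * Real.log D ^ 9) := by
  refine ⟨by rw [bigP, Real.log_exp, ell], by rw [bigT, ell]; norm_num, fun a => ?_⟩
  rw [bigP, ell, ← Real.exp_mul, mul_comm]

omit χ in
/-- The shifts `β_j` (`j = 1, 2, 3`) are purely imaginary of size `≤ (3 + 5c′)α`, `α = π𝓛⁻⁹`.
[cite: Zhang2022LandauSiegel, §2 (2.13)] -/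
theorem betaJ_re_norm {c' : ℝ} (hc' : 0 ≤ c') (hL3 : 3 ≤ Real.log D) {j : ℕ}
    (hj : j ∈ ({1, 2, 3} : Finset ℕ)) :
    (betaJ c' D j).re = 0 ∧ ‖betaJ c' D j‖ ≤ (3 + 5 * c') * π / Real.log D ^ 9 := by
  have hα : alpha D = π / Real.log D ^ 9 := by rw [alpha, bigP, Real.log_exp, ell]
  have hβj : betaJ c' D j ∈ ({Lemma82.beta1 c' (Real.log D), Lemma82.beta2 c' (Real.log D),
      Lemma82.beta3 c' (Real.log D)} : Set ℂ) := by
    simp only [Finset.mem_insert, Finset.mem_singleton] at hj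
    simp only [Set.mem_insert_iff, Set.mem_singleton_iff]
    rcases hj with rfl | rfl | rfl
    · left
      simp only [betaJ, Nat.reduceMod, if_true, beta1, Lemma82.beta1, hα, ell]
      push_cast; ring
    · right; left
      simp only [betaJ, Nat.reduceMod, beta2, Lemma82.beta2, hα, ell]
      norm_num; ring
    · right; right
      simp only [betaJ, Nat.reduceMod, beta3, Lemma82.beta3, hα, ell]
      norm_num; ring
  refine Lemma82.shifts_bound hc' hL3 _ ?_
  simp only [Set.mem_insert_iff, Set.mem_singleton_iff] at hβj ⊢
  tauto

/-- Standing facts for the four ranges, from `1024 + (3+5c′)π ≤ 𝓛`. [cite: Zhang2022LandauSiegel, §10 Lemma 10.1] -/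
theorem setting [NeZero D] {c' : ℝ} (hc' : 0 ≤ c') (hL : 1024 + (3 + 5 * c') * π ≤ Real.log D)
    {j : ℕ} (hj : j ∈ ({1, 2, 3} : Finset ℕ)) :
    200 + (3 + 5 * c') * π ≤ Real.log D ∧ 3 ≤ Real.log D ∧ 1 < bigP D ∧
      (-betaJ c' D j).re = 0 ∧ ‖-betaJ c' D j‖ ≤ (3 + 5 * c') * π / Real.log D ^ 9 ∧
      4 * (3 + 5 * c') * π ≤ Real.log D ^ 8 ∧
      Real.log D ^ (11 / 10 : ℝ) ≤ 2⁻¹ * Real.log D ^ 9 := by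
  have hπ := Real.pi_pos
  have hK0 : 0 ≤ 3 + 5 * c' := by positivity
  have hKπ : 0 ≤ (3 + 5 * c') * π := by positivity
  have hL1024 : 1024 ≤ Real.log D := by linarith
  have hL3 : 3 ≤ Real.log D := by linarith
  have hL1 : 1 ≤ Real.log D := by linarith
  obtain ⟨hre, hn⟩ := betaJ_re_norm (D := D) hc' hL3 hj
  refine ⟨by linarith, hL3, ?_, by simp [hre], by rw [norm_neg]; exact hn, ?_, ?_⟩
  · rw [bigP]; exact Real.one_lt_exp_iff.mpr (by rw [ell]; positivity)
  · calc 4 * (3 + 5 * c') * π = 4 * ((3 + 5 * c') * π) := by ring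
      _ ≤ 4 * Real.log D := by linarith
      _ ≤ Real.log D ^ 7 * Real.log D := by
          refine mul_le_mul_of_nonneg_right ?_ (by linarith)
          calc (4 : ℝ) ≤ 3 ^ 7 := by norm_num
            _ ≤ Real.log D ^ 7 := pow_le_pow_left₀ (by norm_num) hL3 7
      _ = Real.log D ^ 8 := by ring
  · calc Real.log D ^ (11 / 10 : ℝ) ≤ Real.log D ^ ((2 : ℕ) : ℝ) :=
          Real.rpow_le_rpow_of_exponent_le hL1 (by norm_num)
      _ = Real.log D ^ 2 := Real.rpow_natCast _ 2
      _ = Real.log D * Real.log D := by ring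
      _ ≤ 2⁻¹ * Real.log D ^ 8 * Real.log D := by
          refine mul_le_mul_of_nonneg_right ?_ (by linarith)
          have : (2 : ℝ) * Real.log D ≤ Real.log D ^ 8 := by
            calc (2 : ℝ) * Real.log D ≤ Real.log D ^ 7 * Real.log D := by
                  refine mul_le_mul_of_nonneg_right ?_ (by linarith)
                  calc (2 : ℝ) ≤ 3 ^ 7 := by norm_num
                    _ ≤ Real.log D ^ 7 := pow_le_pow_left₀ (by norm_num) hL3 7
              _ = Real.log D ^ 8 := by ring
          linarith
      _ = 2⁻¹ * Real.log D ^ 9 := by ring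

/-! ### §7. The four ranges of Lemma 10.1 -/

/-- **(10.3)**: for `P^{0.5} < y ≤ P^{0.502}/T`,
`𝔳₁ⱼ(y) = (500L′(1,χ)/log P)(−1 − β_j log(y/P^{0.5})) + O(𝓛⁻¹⁵)`.
[cite: Zhang2022LandauSiegel, §10 Lemma 10.1 (10.3)] -/
theorem range_two [NeZero D] (hprim : χ.IsPrimitive) {c' : ℝ} (hc' : 0 ≤ c')
    (hL : 1024 + (3 + 5 * c') * π ≤ Real.log D) (hA : ‖χ.LFunction 1‖ ≤ 1 / Real.log D ^ 2022)
    {j : ℕ} (hj : j ∈ ({1, 2, 3} : Finset ℕ)) {y : ℝ} (h1 : bigP D ^ (0.5 : ℝ) < y)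
    (h2 : y ≤ bigP D ^ (0.502 : ℝ) / bigT D) :
    ‖frakv1 c' χ j y - 500 * deriv χ.LFunction 1 / Real.log (bigP D) *
        (-1 - betaJ c' D j * (Real.log (y / bigP D ^ (0.5 : ℝ)) : ℂ))‖ ≤
      1500 * C82 (3 + 5 * c') / Real.log D ^ 15 := by
  obtain ⟨hlogP, hT, hPa⟩ := params D
  obtain ⟨hL200, hL3, hP1, hδre, hδn, hK4, -⟩ := setting (D := D) hc' hL hj
  have hK0 : 0 ≤ 3 + 5 * c' := by positivity
  set L : ℝ := Real.log D with hLdef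
  set β : ℂ := betaJ c' D j with hβdef
  have hL0 : 0 < L := by linarith
  have hP0 : 0 < bigP D := by linarith
  have hPa0 : ∀ a : ℝ, 0 < bigP D ^ a := fun a => Real.rpow_pos_of_pos hP0 a
  have hT0 : 0 < bigT D := by rw [hT]; exact Real.exp_pos _
  have hy0 : 0 < y := lt_trans (hPa0 _) h1
  have hy1 : 1 ≤ y := by
    refine le_trans ?_ h1.le
    rw [hPa]; exact Real.one_le_exp (by positivity)
  -- logarithms
  set ly : ℝ := Real.log y with hly
  have hly1 : 0.5 * L ^ 9 < ly := by
    have := Real.log_lt_log (hPa0 _) h1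
    rwa [hPa, Real.log_exp] at this
  have hly2 : ly ≤ 0.502 * L ^ 9 - L ^ (11 / 10 : ℝ) := by
    have := Real.log_le_log hy0 h2
    rwa [Real.log_div (hPa0 _).ne' hT0.ne', hPa, Real.log_exp, hT, Real.log_exp] at this
  have hX1log : Real.log (bigP D ^ (0.504 : ℝ) / y) = 0.504 * L ^ 9 - ly := by
    rw [Real.log_div (hPa0 _).ne' hy0.ne', hPa, Real.log_exp]
  have hX2log : Real.log (bigP D ^ (0.502 : ℝ) / y) = 0.502 * L ^ 9 - ly := by
    rw [Real.log_div (hPa0 _).ne' hy0.ne', hPa, Real.log_exp]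
  have hylog : Real.log (y / bigP D ^ (0.5 : ℝ)) = ly - 0.5 * L ^ 9 := by
    rw [Real.log_div hy0.ne' (hPa0 _).ne', hPa, Real.log_exp]
  have hX10 : 0 < bigP D ^ (0.504 : ℝ) / y := by positivity
  have hX20 : 0 < bigP D ^ (0.502 : ℝ) / y := by positivity
  -- the long pieces
  have hL90 : 0 < L ^ 9 := pow_pos hL0 9
  have hA1 := Lemma82.sum_twist_log_sub_main_le χ hprim hL3 hA hK0 hK4 hδre hδn
    (x := bigP D ^ (0.504 : ℝ) / y)
    ((Real.le_log_iff_exp_le hX10).mp (by rw [hX1log, ← hLdef]; linarith))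
    ((Real.log_le_iff_le_exp hX10).mp (by rw [hX1log, ← hLdef]; linarith))
  have hA2 := Lemma82.sum_twist_log_sub_main_le χ hprim hL3 hA hK0 hK4 hδre hδn
    (x := bigP D ^ (0.502 : ℝ) / y)
    ((Real.le_log_iff_exp_le hX20).mp (by rw [hX2log, ← hLdef]; linarith))
    ((Real.log_le_iff_le_exp hX20).mp (by rw [hX2log, ← hLdef]; linarith))
  -- the empty piece
  have hX3 : ⌊bigP D ^ (0.5 : ℝ) / y⌋₊ = 0 :=
    Nat.floor_eq_zero.mpr (by rw [div_lt_one hy0]; exact h1)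
  rw [frakv1_eq χ c' j hy1 hP1, hX3, Finset.Ioc_self, Finset.sum_empty, add_zero]
  -- algebra of the main terms
  set A1 := ∑ m ∈ Finset.Ioc 0 ⌊bigP D ^ (0.504 : ℝ) / y⌋₊, twist χ (-β) m *
    (Real.log (bigP D ^ (0.504 : ℝ) / y / m) : ℂ) with hA1def
  set A2 := ∑ m ∈ Finset.Ioc 0 ⌊bigP D ^ (0.502 : ℝ) / y⌋₊, twist χ (-β) m *
    (Real.log (bigP D ^ (0.502 : ℝ) / y / m) : ℂ) with hA2def
  set m1 : ℂ := deriv χ.LFunction 1 * (1 + -β * (Real.log (bigP D ^ (0.504 : ℝ) / y) : ℂ))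
    with hm1
  set m2 : ℂ := deriv χ.LFunction 1 * (1 + -β * (Real.log (bigP D ^ (0.502 : ℝ) / y) : ℂ))
    with hm2
  have e : ((500 / Real.log (bigP D) : ℝ) : ℂ) * (A1 - 2 * A2) -
      500 * deriv χ.LFunction 1 / Real.log (bigP D) *
        (-1 - β * (Real.log (y / bigP D ^ (0.5 : ℝ)) : ℂ)) =
      ((500 / Real.log (bigP D) : ℝ) : ℂ) * ((A1 - m1) - 2 * (A2 - m2)) := by
    rw [hm1, hm2, hX1log, hX2log, hylog, hlogP]
    push_cast
    ring
  rw [e, norm_mul, Complex.norm_real, Real.norm_of_nonneg (by rw [hlogP]; positivity), hlogP]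
  calc 500 / L ^ 9 * ‖(A1 - m1) - 2 * (A2 - m2)‖
      ≤ 500 / L ^ 9 * (C82 (3 + 5 * c') / L ^ 6 + 2 * (C82 (3 + 5 * c') / L ^ 6)) := by
        refine mul_le_mul_of_nonneg_left ?_ (by positivity)
        refine (norm_sub_le _ _).trans (add_le_add hA1 ?_)
        rw [norm_mul, Complex.norm_two]
        exact mul_le_mul_of_nonneg_left hA2 zero_le_two
    _ = 1500 * C82 (3 + 5 * c') / L ^ 15 := by
        rw [show C82 (3 + 5 * c') / L ^ 6 + 2 * (C82 (3 + 5 * c') / L ^ 6) =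
          3 * C82 (3 + 5 * c') / L ^ 6 by ring, div_mul_div_comm, ← pow_add]
        ring

/-- **(10.4)**: for `P^{0.502} < y ≤ P^{0.504}/T`,
`𝔳₁ⱼ(y) = (500L′(1,χ)/log P)(1 − β_j log(P^{0.504}/y)) + O(𝓛⁻¹⁵)`.
[cite: Zhang2022LandauSiegel, §10 Lemma 10.1 (10.4)] -/
theorem range_three [NeZero D] (hprim : χ.IsPrimitive) {c' : ℝ} (hc' : 0 ≤ c')
    (hL : 1024 + (3 + 5 * c') * π ≤ Real.log D) (hA : ‖χ.LFunction 1‖ ≤ 1 / Real.log D ^ 2022)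
    {j : ℕ} (hj : j ∈ ({1, 2, 3} : Finset ℕ)) {y : ℝ} (h1 : bigP D ^ (0.502 : ℝ) < y)
    (h2 : y ≤ bigP D ^ (0.504 : ℝ) / bigT D) :
    ‖frakv1 c' χ j y - 500 * deriv χ.LFunction 1 / Real.log (bigP D) *
        (1 - betaJ c' D j * (Real.log (bigP D ^ (0.504 : ℝ) / y) : ℂ))‖ ≤
      500 * C82 (3 + 5 * c') / Real.log D ^ 15 := by
  obtain ⟨hlogP, hT, hPa⟩ := params D
  obtain ⟨hL200, hL3, hP1, hδre, hδn, hK4, -⟩ := setting (D := D) hc' hL hj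
  have hK0 : 0 ≤ 3 + 5 * c' := by positivity
  set L : ℝ := Real.log D with hLdef
  set β : ℂ := betaJ c' D j with hβdef
  have hL0 : 0 < L := by linarith
  have hP0 : 0 < bigP D := by linarith
  have hPa0 : ∀ a : ℝ, 0 < bigP D ^ a := fun a => Real.rpow_pos_of_pos hP0 a
  have hT0 : 0 < bigT D := by rw [hT]; exact Real.exp_pos _
  have hy0 : 0 < y := lt_trans (hPa0 _) h1
  have hy1 : 1 ≤ y := by
    refine le_trans ?_ h1.le
    rw [hPa]; exact Real.one_le_exp (by positivity)
  set ly : ℝ := Real.log y with hly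
  have hly1 : 0.502 * L ^ 9 < ly := by
    have := Real.log_lt_log (hPa0 _) h1
    rwa [hPa, Real.log_exp] at this
  have hly2 : ly ≤ 0.504 * L ^ 9 - L ^ (11 / 10 : ℝ) := by
    have := Real.log_le_log hy0 h2
    rwa [Real.log_div (hPa0 _).ne' hT0.ne', hPa, Real.log_exp, hT, Real.log_exp] at this
  have hX1log : Real.log (bigP D ^ (0.504 : ℝ) / y) = 0.504 * L ^ 9 - ly := by
    rw [Real.log_div (hPa0 _).ne' hy0.ne', hPa, Real.log_exp]
  have hX10 : 0 < bigP D ^ (0.504 : ℝ) / y := by positivity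
  have hL90 : 0 < L ^ 9 := pow_pos hL0 9
  have hA1 := Lemma82.sum_twist_log_sub_main_le χ hprim hL3 hA hK0 hK4 hδre hδn
    (x := bigP D ^ (0.504 : ℝ) / y)
    ((Real.le_log_iff_exp_le hX10).mp (by rw [hX1log, ← hLdef]; linarith))
    ((Real.log_le_iff_le_exp hX10).mp (by rw [hX1log, ← hLdef]; linarith))
  -- the empty pieces
  have h05 : bigP D ^ (0.5 : ℝ) < y := by
    refine lt_trans ?_ h1
    rw [hPa, hPa]; exact Real.exp_lt_exp.mpr (by nlinarith [pow_pos hL0 9])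
  have hX2 : ⌊bigP D ^ (0.502 : ℝ) / y⌋₊ = 0 :=
    Nat.floor_eq_zero.mpr (by rw [div_lt_one hy0]; exact h1)
  have hX3 : ⌊bigP D ^ (0.5 : ℝ) / y⌋₊ = 0 :=
    Nat.floor_eq_zero.mpr (by rw [div_lt_one hy0]; exact h05)
  rw [frakv1_eq χ c' j hy1 hP1, hX2, hX3, Finset.Ioc_self, Finset.sum_empty, Finset.sum_empty,
    mul_zero, sub_zero, add_zero]
  set A1 := ∑ m ∈ Finset.Ioc 0 ⌊bigP D ^ (0.504 : ℝ) / y⌋₊, twist χ (-β) m *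
    (Real.log (bigP D ^ (0.504 : ℝ) / y / m) : ℂ) with hA1def
  set m1 : ℂ := deriv χ.LFunction 1 * (1 + -β * (Real.log (bigP D ^ (0.504 : ℝ) / y) : ℂ))
    with hm1
  have e : ((500 / Real.log (bigP D) : ℝ) : ℂ) * A1 -
      500 * deriv χ.LFunction 1 / Real.log (bigP D) *
        (1 - β * (Real.log (bigP D ^ (0.504 : ℝ) / y) : ℂ)) =
      ((500 / Real.log (bigP D) : ℝ) : ℂ) * (A1 - m1) := by
    rw [hm1]
    push_cast
    ring
  rw [e, norm_mul, Complex.norm_real, Real.norm_of_nonneg (by rw [hlogP]; positivity), hlogP]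
  calc 500 / L ^ 9 * ‖A1 - m1‖ ≤ 500 / L ^ 9 * (C82 (3 + 5 * c') / L ^ 6) :=
        mul_le_mul_of_nonneg_left hA1 (by positivity)
    _ = 500 * C82 (3 + 5 * c') / L ^ 15 := by
        rw [div_mul_div_comm, ← pow_add]

omit χ in
/-- The consecutive differences of `m ↦ m^{s}f̃(log(ym)/log P)` (`Re s = −1`, `‖s‖ ≤ 2`, `n ≥ 2`,
`log P ≥ 2000`): `≤ 5/(n(n+1))`. [cite: Zhang2022LandauSiegel, §10 proof of (10.2)] -/
theorem norm_fweight_sub_succ_le {s : ℂ} (hsre : s.re = -1) (hs2 : ‖s‖ ≤ 2) {y L9 : ℝ}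
    (hy : 0 < y) (hL9 : 2000 ≤ L9) {n : ℕ} (hn2 : 2 ≤ n) :
    ‖(n : ℂ) ^ s * (ftilde (Real.log (y * n) / L9) : ℂ) -
        ((n + 1 : ℕ) : ℂ) ^ s * (ftilde (Real.log (y * ((n + 1 : ℕ) : ℝ)) / L9) : ℂ)‖ ≤
      5 / ((n : ℝ) * (n + 1)) := by
  have hn0 : (0 : ℝ) < n := by exact_mod_cast (by omega : 0 < n)
  have hn1 : (0 : ℝ) < ((n + 1 : ℕ) : ℝ) := by positivity
  have hL90 : 0 < L9 := by linarith
  set f0 : ℝ := ftilde (Real.log (y * n) / L9) with hf0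
  set f1 : ℝ := ftilde (Real.log (y * ((n + 1 : ℕ) : ℝ)) / L9) with hf1
  have h1 : ‖(n : ℂ) ^ s - ((n + 1 : ℕ) : ℂ) ^ s‖ ≤ 4 / ((n : ℝ) * (n + 1)) :=
    norm_cpow_sub_cpow_succ_le hn2 hsre hs2
  have h2 : ‖((n + 1 : ℕ) : ℂ) ^ s‖ = 1 / ((n : ℝ) + 1) := by
    rw [Complex.norm_natCast_cpow_of_pos (Nat.succ_pos n), hsre, Real.rpow_neg_one]
    push_cast
    rw [one_div]
  have hf0n : ‖(f0 : ℂ)‖ ≤ 1 := by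
    rw [Complex.norm_real, Real.norm_of_nonneg (ftilde_nonneg _)]; exact ftilde_le_one _
  have hdiff : ‖((f0 - f1 : ℝ) : ℂ)‖ ≤ 1 / n := by
    rw [Complex.norm_real, Real.norm_eq_abs, hf0, hf1]
    refine (abs_ftilde_sub_le _ _).trans ?_
    have hlg : Real.log (y * n) / L9 - Real.log (y * ((n + 1 : ℕ) : ℝ)) / L9 =
        -((Real.log ((n + 1 : ℕ) : ℝ) - Real.log n) / L9) := by
      rw [Real.log_mul hy.ne' hn0.ne', Real.log_mul hy.ne' hn1.ne']
      ring
    have hld0 : 0 ≤ Real.log ((n + 1 : ℕ) : ℝ) - Real.log n := by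
      rw [sub_nonneg]; exact Real.log_le_log hn0 (by push_cast; linarith)
    have hld1 : Real.log ((n + 1 : ℕ) : ℝ) - Real.log n ≤ 1 / n := by
      rw [← Real.log_div hn1.ne' hn0.ne']
      calc Real.log (((n + 1 : ℕ) : ℝ) / n) ≤ ((n + 1 : ℕ) : ℝ) / n - 1 :=
            Real.log_le_sub_one_of_pos (by positivity)
        _ = 1 / n := by push_cast; field_simp; ring
    rw [hlg, abs_neg, abs_div, abs_of_nonneg hld0, abs_of_pos hL90]
    calc 2000 * ((Real.log ((n + 1 : ℕ) : ℝ) - Real.log n) / L9) ≤ 2000 * ((1 / n) / 2000) := by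
          gcongr
      _ = 1 / n := by ring
  have e : (n : ℂ) ^ s * (f0 : ℂ) - ((n + 1 : ℕ) : ℂ) ^ s * (f1 : ℂ) =
      ((n : ℂ) ^ s - ((n + 1 : ℕ) : ℂ) ^ s) * (f0 : ℂ) +
        ((n + 1 : ℕ) : ℂ) ^ s * ((f0 - f1 : ℝ) : ℂ) := by
    push_cast; ring
  rw [e]
  calc _ ≤ ‖(n : ℂ) ^ s - ((n + 1 : ℕ) : ℂ) ^ s‖ * ‖(f0 : ℂ)‖ +
        ‖((n + 1 : ℕ) : ℂ) ^ s‖ * ‖((f0 - f1 : ℝ) : ℂ)‖ := by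
        refine (norm_add_le _ _).trans ?_
        rw [norm_mul, norm_mul]
    _ ≤ 4 / ((n : ℝ) * (n + 1)) * 1 + 1 / ((n : ℝ) + 1) * (1 / n) := by
        refine add_le_add (mul_le_mul h1 hf0n (norm_nonneg _) (by positivity)) ?_
        rw [h2]
        exact mul_le_mul_of_nonneg_left hdiff (by positivity)
    _ = 5 / ((n : ℝ) * (n + 1)) := by
        field_simp
        ring


end Literature.NumberTheory.LFunctions.Zhang2022.Lemma101
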